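/-
Copyright (c) 2026. All rights reserved.
Released under Apache 2.0 license as described in the file LICENSE.
Authors: abc-iut cell, prover seat abc-iut-w4-d095 (wave 4, gen 5), over abc-iut-L4-t3's add-on (see the imports).
-/
import Literature.AnabelianGeometry.AbsoluteAnabelian.LogFrobeniusMonoTelecoreCoherence
import Literature.AnabelianGeometry.AbsoluteAnabelian.LogFrobeniusMonoGenuineTelecoreNegative
import Literature.AnabelianGeometry.AbsoluteAnabelian.AbsTopIII.BiAnabelianModelProofs
import HarnessLib

/-!
# [AbsTopIII] Cor 5.10 (iv)(b)(c): the telecore add-on `MonoTelecoreCoherence` at the genuine-mono MLF setting — (c) holds, (d) is empty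

S. Mochizuki, *Topics in absolute anabelian geometry III: global reconstruction algorithms*, J. Math. Sci. Univ.
Tokyo 22 (2015) 939–1156 [MochizukiAbsTopIII2015]; locators = pages of the author's manuscript
(`paper:url-5493eb38cbb7`): Prop 5.8 (vii) pp. 141–142 (the forgetful functors `ψ^{An⊢⊞}_{w,ν} : An⊢[𝒩⊢⊞_w] → 𝒩⊢⊞_w`),
Cor 5.10 (iv)(b)(c) pp. 147–148 (the mono-analytic telecore `𝔗_{An⊢}` and the natural isomorphisms `η⊢_{v,ν}`), Prop 5.8
(i)–(iii) p. 139 (the mono-anabelian containers reconstructed from `G`), Def 5.4 (iii) p. 126 (the vertex `𝒪^×_k̄`).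

PROOF-ONLY genuine-carrier census (D-0079 L-F sub-cell [AbsTop*]+[AbsAnab]; row «MTC-GENUINE», abc-iut-L4-t3's
first-refusal grant 17:05Z) of abc-iut-L4-t3's interface add-on `LogFrobeniusSetting.MonoTelecoreCoherence M`
(GAP-LEDGER G-f101-2 (c)(d): `psiOver` = "`ψ` lies over `ℰ⊢`", `eta` = the printed `η⊢_{v,ν}`, `eta_over` = its
coherence) AT this seat's setting `LogFrobeniusSetting.nonarchGenuineMono p` (genuine nonarchimedean rows 1–4 over the
MLF model, genuine mono-analytic rows `ℰ⊢ := Up 𝒯𝔾` via `W ↦ G_w`, `𝒩⊢ := ℰ⊢ × 𝒞_TS` via `(Π ↷ M) ↦ (G ↷ M)`; telecore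
edges `ψ := G ↦ (G, (G ↷ pt))` the declared PLACEHOLDER):

* `nonarchGenuineMono_psiOver_eq` / `_nonempty_psiOver` — (c) HOLDS, on the nose (the composite IS `κ_{An⊢}⁻¹`);
* `nonarchGenuineMono_exists_isEmpty_eta` — (d) FAILS: at the vertex `𝒪^×_k̄` of a nonarchimedean place the type of
  `η⊢_{v,𝒪^×}` is EMPTY (at a model pair `x₀`, projected to the local `TS`-components, an inhabitant would be an isomorphism
  `(G ↷ pt) ≅ (G ↷ 𝒪^×_k̄)` in `𝒞_TS`; `1 ≠ −1` in `𝒪^×_k̄`) — the mechanism of `nonarchGenuineMono_not_cor510MonoTelecore`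
  isolated on the `η⊢`-type;
* `nonarchGenuineMono_isEmpty_monoTelecoreCoherence` (+ the primed form with the model-pair binder discharged by
  abc-iut-L4-t9's `TFModel.monoAnalytic p ⊥`) — hence the add-on has NO instance at this setting, for every `M`;
* `nonarchGenuineMono_cores_not_telecoreCoherence` — contrast in one line: (a) inhabited and Cor 5.10 (iv)(a) holds
  (`nonarchGenuineMono_cor510MonoCores`), (c)(d) empty.

READING (honest): the placeholder is detected, nothing about print is impugned — at a carrier whose `ℰ⊢` is genuinely
mono-analytic (bare topological groups) the datum (d) requires telecore edges carrying the Prop 5.8 (i)–(iii) containers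
`G ↦ (G ↷ 𝒪^×(G))` FUNCTORIALLY IN ISOMORPHISMS OF `G` (local class field theory / [AbsAnab] Prop 1.2.1, FACT-LIST) —
the content the genuine unit of F-0139 must supply; consequently abc-iut-f-101's pinned Cor 5.10 (iv)(b)(c) assembly over
`(M, K)` has no instance here either.  Refereed pre-IUT material; nothing here bears on [IUTchIII] Cor. 3.12; no side
taken; model-level ≠ node-level.
-/

set_option autoImplicit false

noncomputable section

open CategoryTheory

namespace Literature.AnabelianGeometry.AbsoluteAnabelian

namespace LogFrobeniusSetting

section Genuine

open AbsTopIII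

variable (p : ℕ) [Fact p.Prime] (Vmod : Type 1) (isArc : Vmod → Bool)

/-- **(c) HOLDS at the genuine-mono MLF setting, ON THE NOSE**: the placeholder telecore edges `ψ := G ↦ (G, (G ↷ pt))`
followed by `𝒩⊢⊞ → 𝒩⊢ → ℰ⊢` ARE the functor `κ_{An⊢}⁻¹ = 𝟭` (`ψ ⋙ 𝟭 ⋙ pr₁ = 𝟭`). [cite: MochizukiAbsTopIII2015, Prop 5.8 (vii) p. 141] -/
theorem nonarchGenuineMono_psiOver_eq (w : Vmod) (j : {ν : LogVertex (isArc w) // ν.IsCross}) :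
    (nonarchGenuineMono p Vmod isArc).ψAnMono w j ⋙ (nonarchGenuineMono p Vmod isArc).forgetMono w ⋙
        (nonarchGenuineMono p Vmod isArc).toEmono w =
      (nonarchGenuineMono p Vmod isArc).κAnMono.inverse :=
  rfl

/-- Hence the (c)-component `psiOver` of the add-on is inhabited at this setting (by the canonical identification).
[cite: MochizukiAbsTopIII2015, Prop 5.8 (vii) p. 141] -/
theorem nonarchGenuineMono_nonempty_psiOver (w : Vmod) (j : {ν : LogVertex (isArc w) // ν.IsCross}) :
    Nonempty ((nonarchGenuineMono p Vmod isArc).ψAnMono w j ⋙ (nonarchGenuineMono p Vmod isArc).forgetMono w ⋙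
        (nonarchGenuineMono p Vmod isArc).toEmono w ≅
      (nonarchGenuineMono p Vmod isArc).κAnMono.inverse) :=
  ⟨eqToIso (nonarchGenuineMono_psiOver_eq p Vmod isArc w j)⟩

/-- **(d) FAILS at the genuine-mono MLF setting, at the vertex `𝒪^×_k̄` of any nonarchimedean place**: there is NO natural
isomorphism `η⊢_{v,𝒪^×}` between the functors of `γ¹ = 𝒳 → 𝒩⊞_v → 𝒩_v → ℰ• → ℰ⊢ → An⊢ →(ψ) 𝒩⊢⊞_v` and `γ⁰ = 𝒳 → 𝒩⊞_v → 𝒩⊢⊞_v`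
— evaluated at a model pair `x₀` and projected to the local `TS`-components it would be an isomorphism
`(G ↷ pt) ≅ (G ↷ 𝒪^×_k̄)` in `𝒞_TS`, impossible since `1 ≠ −1` in `𝒪^×_k̄` (the mechanism of
`nonarchGenuineMono_not_cor510MonoTelecore`, isolated on the `η⊢`-type). [cite: MochizukiAbsTopIII2015, Cor 5.10 (iv)(c) p. 148] -/
theorem nonarchGenuineMono_exists_isEmpty_eta (v₀ : Vmod) (hv₀ : isArc v₀ = false) (x₀ : Up (TFModel p)) :
    ∃ (ν : LogVertex (isArc v₀)) (hν : ν.IsCross),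
      IsEmpty ((nonarchGenuineMono p Vmod isArc).lam v₀ ν ⋙ (nonarchGenuineMono p Vmod isArc).forget v₀ ⋙
          (nonarchGenuineMono p Vmod isArc).toE v₀ ⋙ (nonarchGenuineMono p Vmod isArc).monoAn ⋙
          (nonarchGenuineMono p Vmod isArc).κAnMono.functor ⋙ (nonarchGenuineMono p Vmod isArc).ψAnMono v₀ ⟨ν, hν⟩ ≅
        (nonarchGenuineMono p Vmod isArc).lam v₀ ν ⋙ (nonarchGenuineMono p Vmod isArc).monoNplus v₀) := by
  obtain ⟨ν, hν, hlam⟩ := exists_cross_units p (isArc v₀) hv₀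
  refine ⟨ν, hν, ⟨fun e => ?_⟩⟩
  rw [show (nonarchGenuineMono p Vmod isArc).lam v₀ ν = Up.liftF ((𝟭 (TFModel p)).prod' (TFModel.lamUnits p)) from hlam]
    at e
  -- the isomorphism at `x₀`, projected to the local `TS`-pair components: `(G ↷ pt) ≅ (G ↷ 𝒪^×_k̄)` in `𝒞_TS`
  let η := (inducedFunctor (ULift.down : ULift.{2} (TopGroupObj × TSObj) → TopGroupObj × TSObj) ⋙
    CategoryTheory.Prod.snd TopGroupObj TSObj).mapIso (e.app x₀)
  have key : ∀ u, (η.hom : TSObj.Hom _ _).homM ((η.inv : TSObj.Hom _ _).homM u) = u := fun u => by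
    have := congrArg (fun k => (k : TSObj.Hom _ _).homM u) η.inv_hom_id
    simp only [TSObj.comp_homM_apply, TSObj.id_homM_apply] at this
    exact this
  have hsub : ∀ u u', u = u' := fun u u' => by
    have hg : (η.inv : TSObj.Hom _ _).homM u = (η.inv : TSObj.Hom _ _).homM u' := rfl
    rw [← key u, ← key u', hg]
  have h1 := congrArg UnitsCarrier.val
    (hsub (UnitsCarrier.mk 1 (Submonoid.one_mem _)) (UnitsCarrier.mk (-1) neg_one_mem_unitSubmonoid))
  change (1 : PadicAlgCl p) = -1 at h1
  haveI : CharZero (PadicAlgCl p) := charZero_of_injective_algebraMap (algebraMap ℚ_[p] (PadicAlgCl p)).injective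
  exact two_ne_zero (α := PadicAlgCl p) (by linear_combination h1)

/-- **abc-iut-L4-t3's add-on `MonoTelecoreCoherence` (GAP-LEDGER G-f101-2 (c)(d)) has NO instance at the genuine-mono MLF
setting** (any mono-analyticization homotopies `M`, any index set with a nonarchimedean place, any model pair `x₀`): its
field `eta` at the vertex `𝒪^×_k̄` is empty.  READING (honest): (c) is met by the placeholder telecore edges, (d) is not —
at a genuinely mono-analytic `ℰ⊢` the printed `η⊢_{v,ν}` needs telecore edges carrying the Prop 5.8 (i)–(iii) containers
`G ↦ (G ↷ 𝒪^×(G))` functorial in isomorphisms of `G` (local class field theory, FACT-LIST); so the pinned Cor 5.10 (iv)(b)(c)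
assembly over `(M, K)` has no instance here either.  Nothing about print is impugned. [cite: MochizukiAbsTopIII2015, Cor 5.10 (iv)(c) p. 148] -/
theorem nonarchGenuineMono_isEmpty_monoTelecoreCoherence (M : (nonarchGenuineMono p Vmod isArc).MonoAnalyticizationHomotopies)
    (v₀ : Vmod) (hv₀ : isArc v₀ = false) (x₀ : Up (TFModel p)) :
    IsEmpty ((nonarchGenuineMono p Vmod isArc).MonoTelecoreCoherence M) := by
  obtain ⟨ν, hν, h⟩ := nonarchGenuineMono_exists_isEmpty_eta p Vmod isArc v₀ hv₀ x₀
  exact ⟨fun K => h.false (K.eta v₀ ν hν)⟩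

/-- The same with the model-pair binder discharged by abc-iut-L4-t9's mono-analytic model object over `ℚ_p`
(`TFModel.monoAnalytic p ⊥`: `Π := G_{ℚ_p}`, `ε = id`): over every index set with a nonarchimedean place the add-on is
EMPTY at the genuine-mono MLF setting, for every `M`. [cite: MochizukiAbsTopIII2015, Cor 5.10 (iv)(c) p. 148] -/
theorem nonarchGenuineMono_isEmpty_monoTelecoreCoherence' (M : (nonarchGenuineMono p Vmod isArc).MonoAnalyticizationHomotopies)
    (v₀ : Vmod) (hv₀ : isArc v₀ = false) : IsEmpty ((nonarchGenuineMono p Vmod isArc).MonoTelecoreCoherence M) :=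
  nonarchGenuineMono_isEmpty_monoTelecoreCoherence p Vmod isArc M v₀ hv₀ (ULift.up (TFModel.monoAnalytic p ⊥))

/-- Contrast, in one line: at the genuine-mono MLF setting the mono-analyticization homotopies (a) are inhabited
(`nonarchGenuineMono_monoAnalyticizationHomotopies`) and Cor 5.10 (iv)(a) holds, while the telecore add-on (c)(d) is empty.
[cite: MochizukiAbsTopIII2015, Cor 5.10 (iv) pp. 147–148] -/
theorem nonarchGenuineMono_cores_not_telecoreCoherence (v₀ : Vmod) (hv₀ : isArc v₀ = false) (x₀ : Up (TFModel p)) :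
    (nonarchGenuineMono p Vmod isArc).Cor510MonoCores ∧
      IsEmpty ((nonarchGenuineMono p Vmod isArc).MonoTelecoreCoherence
        (nonarchGenuineMono_monoAnalyticizationHomotopies p Vmod isArc)) :=
  haveI : Nonempty Vmod := ⟨v₀⟩
  ⟨nonarchGenuineMono_cor510MonoCores p Vmod isArc,
    nonarchGenuineMono_isEmpty_monoTelecoreCoherence p Vmod isArc _ v₀ hv₀ x₀⟩

end Genuine

end LogFrobeniusSetting

end Literature.AnabelianGeometry.AbsoluteAnabelian

end
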